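import Summits.KontsevichZagierPeriods.KontsevichZagierPeriods.Theses.HurwitzMicroSectors
import Summits.KontsevichZagierPeriods.KontsevichZagierPeriods.Theorems.HurwitzMicroSectorsNormalFormPrinciplePiBoxTransfer
import Summits.KontsevichZagierPeriods.KontsevichZagierPeriods.Theorems.HurwitzMicroSectorsNormalFormPrincipleVariants2247

/-! TTRL-lite variant V2249 of stmt-KontsevichZagierPeriods-3869

Variant V2249 = `stub_boxRigidity` (the leaf `BoxRigidity` of `NormalFormPrinciple`: two representations
on open unit boxes with integrands of KZ's rational shape `p/q` over `ℚ` and equal values are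
KZ-equivalent) under the TWO-sided move `bound_nat:m≤3; bound_nat:m'≤4` (left dimension `≤ 3`, right
dimension `≤ 4`; the hypotheses arrive in the order `m' ≤ 4 → m ≤ 3`). Verdict of the attempt seat:
**open** — this file is the exact-strength certificate, not a proof of the variant. For every `K` let
`BoxVanishing K` say that a box-rational representation of dimension `K` and value `0` is a relation.
A two-sided bound is `BoxVanishing` of the LARGEST dimension allowed (toolkit of `…Variants2238`:
`boxVanishingDim_right_of_pair`, `boxRigidityLe_of_boxVanishingDim`, `boxVanishingDim_mono`). Hence

* `stub_boxRigidity_var2249_iff_boxVanishing_four`: V2249 ⟺ **BoxVanishing 4** ((⇒) the pair `(0, 4)`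
  is allowed: compare a vanishing `4`-box representation with the zero representation on the `0`-box;
  (⇐) pad both representations to the `4`-box and subtract there);
* `stub_boxRigidity_var2249_iff_le_four`: V2249 ⟺ BoxRigidity for ALL `m, m' ≤ 4` — the bound `m ≤ 3`
  is idle; Conjecture 1 of Kontsevich–Zagier for every pair of rational integrands on `(0,1)^{≤4}`;
* `stub_boxRigidity_var2249_iff_var2247` / `stub_boxRigidity_var2249_iff_var2265`: V2249 is literally the
  siblings V2247 (`(m, m') = (3, 4)` frozen) and V2265 (`(4, 2)` frozen) — all three are `BoxVanishing 4`;
* `boxVanishing_le_four_of_stub_boxRigidity_var2249`: V2249 gives `BoxVanishing j` for every `j ≤ 4`, so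
  it contains the square (`BoxVanishing 2`: for `a b : ℚ`, "`a + b·G = 0 ⇒ [a + b/(1+x²y²)]_{(0,1)²}` is a
  relation", `G` Catalan's constant — provable today only through the irrationality of `G` (open) or an
  explicit chain of moves, none of which can exist unless `G ∈ ℚ`) and the cube (`BoxVanishing 3`, the
  `ζ(3) ∈ ℚ + ℚπ²` case split). `BoxVanishing 1` is the tree's theorem `boxRigidity_of_le_one` (Baker);
  dimension `2` is the first open one and V2249 sits two rungs above it;
* `stub_boxRigidity_var2249_of_parent` / `_of_statement`: parent leaf ⇒ V2249 and
  `KontsevichZagierPeriods ⇒ V2249`, so a refutation of the variant would refute Conjecture 1 for the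
  tree's calculus — the variant is neither provable nor refutable from the tree today.

Source: M. Kontsevich, D. Zagier, *Periods* (2001), §1.2 Conjecture 1. Pure proof file, no definitions. -/

-- `Summit.<Summit>.<Problem>` is the tree's mandated summit-side namespace (CONVENTIONS §2); for this
-- single-conjunct summit the two coincide, so the duplicate is deliberate.
set_option linter.dupNamespace false

noncomputable section

namespace Summit.KontsevichZagierPeriods.KontsevichZagierPeriods.Theorems

open MeasureTheory Set
open Literature.NumberTheory.Transcendental Literature.NumberTheory.Transcendental.KZ
open Summit.KontsevichZagierPeriods.KontsevichZagierPeriods.Theses.HurwitzMicroSectors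
open Summit.KontsevichZagierPeriods.HurwitzMicroSectors.NormalFormPrinciple.PiBox

/-! ## The variant V2249 itself: exactly `BoxVanishing 4` -/

/-- **V2249 ⟺ `BoxVanishing 4`**: (⇒) the pair `(m, m') = (0, 4)` is allowed (`0 ≤ 3`, `4 ≤ 4`), so
`boxVanishingDim_right_of_pair 0 4`; (⇐) `boxRigidityLe_of_boxVanishingDim 4` with `m ≤ 3 ≤ 4`,
`m' ≤ 4`. [cite: KontsevichZagier2001, §1.2 Conjecture 1] -/
theorem stub_boxRigidity_var2249_iff_boxVanishing_four :
    (∀ (m m' : ℕ) (N : IntegralRep m) (N' : IntegralRep m'), m' ≤ 4 → m ≤ 3 → N.domain = {x | ∀ i, x i ∈ Set.Ioo (0:ℝ) 1} → N.IsRational → N'.domain = {x | ∀ i, x i ∈ Set.Ioo (0:ℝ) 1} → N'.IsRational → N.value = N'.value → Equivalent N N') ↔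
    (∀ (M : IntegralRep 4), M.domain = {x | ∀ i, x i ∈ Set.Ioo (0:ℝ) 1} → M.IsRational →
      M.value = 0 → of M ∈ relations) :=
  ⟨fun h => boxVanishingDim_right_of_pair 0 4 fun N N' => h 0 4 N N' le_rfl (Nat.zero_le 3),
    fun hvan m m' N N' hm' hm =>
      boxRigidityLe_of_boxVanishingDim 4 hvan m m' N N' (hm.trans (by norm_num)) hm'⟩

/-- **V2249 ⟺ `BoxRigidity` for all `m, m' ≤ 4`** (the honest strength of the variant: the extra bound
`m ≤ 3` is idle; so V2249 coincides with the two-sided variants `bound_nat:m≤4; bound_nat:m'≤4` and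
`fix_nat:m=j; fix_nat:m'=k` for every `max j k = 4`). [cite: KontsevichZagier2001, §1.2 Conjecture 1] -/
theorem stub_boxRigidity_var2249_iff_le_four :
    (∀ (m m' : ℕ) (N : IntegralRep m) (N' : IntegralRep m'), m' ≤ 4 → m ≤ 3 → N.domain = {x | ∀ i, x i ∈ Set.Ioo (0:ℝ) 1} → N.IsRational → N'.domain = {x | ∀ i, x i ∈ Set.Ioo (0:ℝ) 1} → N'.IsRational → N.value = N'.value → Equivalent N N') ↔
    (∀ (m m' : ℕ) (N : IntegralRep m) (N' : IntegralRep m'), m ≤ 4 → m' ≤ 4 →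
      N.domain = {x | ∀ i, x i ∈ Set.Ioo (0:ℝ) 1} → N.IsRational →
      N'.domain = {x | ∀ i, x i ∈ Set.Ioo (0:ℝ) 1} → N'.IsRational →
      N.value = N'.value → Equivalent N N') := by
  rw [stub_boxRigidity_var2249_iff_boxVanishing_four]
  exact ⟨fun hvan => boxRigidityLe_of_boxVanishingDim 4 hvan,
    fun h => boxVanishingDim_left_of_pair 4 4 fun N N' => h 4 4 N N' le_rfl le_rfl⟩

/-- **V2249 ⟺ the sibling V2247** (`fix_nat:m=3; fix_nat:m'=4`): both are `BoxVanishing 4`.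
[cite: KontsevichZagier2001, §1.2 Conjecture 1] -/
theorem stub_boxRigidity_var2249_iff_var2247 :
    (∀ (m m' : ℕ) (N : IntegralRep m) (N' : IntegralRep m'), m' ≤ 4 → m ≤ 3 → N.domain = {x | ∀ i, x i ∈ Set.Ioo (0:ℝ) 1} → N.IsRational → N'.domain = {x | ∀ i, x i ∈ Set.Ioo (0:ℝ) 1} → N'.IsRational → N.value = N'.value → Equivalent N N') ↔
    (∀ (N : IntegralRep 3) (N' : IntegralRep 4), N.domain = {x | ∀ i, x i ∈ Set.Ioo (0:ℝ) 1} → N.IsRational → N'.domain = {x | ∀ i, x i ∈ Set.Ioo (0:ℝ) 1} → N'.IsRational → N.value = N'.value → Equivalent N N') := by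
  rw [stub_boxRigidity_var2249_iff_boxVanishing_four, stub_boxRigidity_var2247_iff_boxVanishing_four]

/-- **V2249 ⟺ the sibling V2265** (`fix_nat:m=4; fix_nat:m'=2`): both are `BoxVanishing 4`.
[cite: KontsevichZagier2001, §1.2 Conjecture 1] -/
theorem stub_boxRigidity_var2249_iff_var2265 :
    (∀ (m m' : ℕ) (N : IntegralRep m) (N' : IntegralRep m'), m' ≤ 4 → m ≤ 3 → N.domain = {x | ∀ i, x i ∈ Set.Ioo (0:ℝ) 1} → N.IsRational → N'.domain = {x | ∀ i, x i ∈ Set.Ioo (0:ℝ) 1} → N'.IsRational → N.value = N'.value → Equivalent N N') ↔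
    (∀ (N : IntegralRep 4) (N' : IntegralRep 2), N.domain = {x | ∀ i, x i ∈ Set.Ioo (0:ℝ) 1} → N.IsRational → N'.domain = {x | ∀ i, x i ∈ Set.Ioo (0:ℝ) 1} → N'.IsRational → N.value = N'.value → Equivalent N N') := by
  rw [stub_boxRigidity_var2249_iff_boxVanishing_four, stub_boxRigidity_var2265_iff_boxVanishing_four]

/-- **V2249 ⇒ `BoxVanishing` in every dimension `≤ 4`** (monotonicity by padding), in particular the
square, which contains Catalan's dichotomy, and the cube. [cite: KontsevichZagier2001, §1.2 Conjecture 1] -/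
theorem boxVanishing_le_four_of_stub_boxRigidity_var2249
    (h : ∀ (m m' : ℕ) (N : IntegralRep m) (N' : IntegralRep m'), m' ≤ 4 → m ≤ 3 → N.domain = {x | ∀ i, x i ∈ Set.Ioo (0:ℝ) 1} → N.IsRational → N'.domain = {x | ∀ i, x i ∈ Set.Ioo (0:ℝ) 1} → N'.IsRational → N.value = N'.value → Equivalent N N')
    {j : ℕ} (hj : j ≤ 4) (N : IntegralRep j) (hNd : N.domain = {x | ∀ i, x i ∈ Set.Ioo (0:ℝ) 1})
    (hNr : N.IsRational) (hv : N.value = 0) : of N ∈ relations :=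
  boxVanishingDim_mono hj (stub_boxRigidity_var2249_iff_boxVanishing_four.1 h) N hNd hNr hv

/-! ## V2249 follows from the parent leaf and from the Summit -/

/-- **The parent leaf ⇒ V2249** (drop the two bounds; the converse is not claimed — the parent is
`BoxVanishing` in ALL dimensions). [cite: KontsevichZagier2001, §1.2 Conjecture 1] -/
theorem stub_boxRigidity_var2249_of_parent
    (h : ∀ (m m' : ℕ) (N : IntegralRep m) (N' : IntegralRep m'), N.domain = {x | ∀ i, x i ∈ Set.Ioo (0:ℝ) 1} → N.IsRational → N'.domain = {x | ∀ i, x i ∈ Set.Ioo (0:ℝ) 1} → N'.IsRational → N.value = N'.value → Equivalent N N') :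
    ∀ (m m' : ℕ) (N : IntegralRep m) (N' : IntegralRep m'), m' ≤ 4 → m ≤ 3 → N.domain = {x | ∀ i, x i ∈ Set.Ioo (0:ℝ) 1} → N.IsRational → N'.domain = {x | ∀ i, x i ∈ Set.Ioo (0:ℝ) 1} → N'.IsRational → N.value = N'.value → Equivalent N N' :=
  fun m m' N N' _ _ => h m m' N N'

/-- **`KontsevichZagierPeriods ⇒ V2249`**: the variant is a special case of Conjecture 1 for the tree's
calculus (`leaves_of_statement`) — so a refutation of the variant would refute the Summit.
[cite: KontsevichZagier2001, §1.2 Conjecture 1] -/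
theorem stub_boxRigidity_var2249_of_statement (h : _root_.KontsevichZagierPeriods) :
    ∀ (m m' : ℕ) (N : IntegralRep m) (N' : IntegralRep m'), m' ≤ 4 → m ≤ 3 → N.domain = {x | ∀ i, x i ∈ Set.Ioo (0:ℝ) 1} → N.IsRational → N'.domain = {x | ∀ i, x i ∈ Set.Ioo (0:ℝ) 1} → N'.IsRational → N.value = N'.value → Equivalent N N' :=
  stub_boxRigidity_var2249_of_parent (leaves_of_statement h).1

end Summit.KontsevichZagierPeriods.KontsevichZagierPeriods.Theorems

end
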